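import Summits.QuantumFields.BalabanUV.T4Continuum.Support.NE7MinimiserLipschitzChart
import Summits.QuantumFields.BalabanUV.T4Continuum.Support.NE7FibreStraightening
import HarnessLib

/-!
# NE7MinimalActionDifferentiable — THE MINIMAL ACTION `A_{j+1}(V)` IS DIFFERENTIABLE IN THE DATUM AT EVERY GENERIC SMALL DATUM (d = 4, every U(n), every L ≥ 2): if the coarse stabiliser
# of `V₀` acts trivially on configurations (true for generic data: the stabiliser is the centre), then `y ↦ minAct (chart_{V₀} y)` has a Fréchet derivative at `y = 0`, namely
# `w · ∂_y [A(chart_{U♯} θ(y, Φ))]_{(0,0)}` — the Lagrange multiplier of the constrained problem read through the straightening `θ` (✓ p821389) — an ENVELOPE theorem: the upper bound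
# `A(y) ≤ w·f(y,0)` (the straightened competitor) and the lower bound `A(y) ≥ A(0) + w·(f(y,Φ_y) − f(0,Φ_y))` at the Lipschitz-close stabiliser copy `Φ_y`, `‖Φ_y‖ ≤ C‖y‖` (✓ p823122),
# differ from the linear term by `o(‖y‖)` because `f` is differentiable at `0`; beyond gen 113's Lipschitz continuity of the minimal action (✓ p820475)

Cell `pub-balaban`, rung (B)+1 sub-cell t4, lineage `b2b-balaban-t4-ne7-p1` (CRUX PROVER NE7 #1 = OWNER of BINDER row NE7), generation 114.  Memo `t4/b2b-balaban-t4-ne7-p1-g114/ROAD-G114.md` §8.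
WHAT ([folklore]; 0 def, 0 sorry).  **`minAct_hasFDerivAt_generic`** (statement in the theorem's docstring).
HONEST FRAMING (page 1): soft calculus over landed kernel theorems; the GENERICITY hypothesis (the unitary `N`-periodic coarse gauges fixing `V₀` fix every configuration) excludes data with a
larger stabiliser — there the value function can have a Danskin kink unless the multiplier is constant on the minimal orbit (memo §8); derivative AT the base datum only (not C¹ on a
neighbourhood); nothing of Bałaban's asserted and NOT his method; NOT NE7 as a spine node, NOT NE3; spine 0∕9; NOT infinite volume, NOT mass gap, NOT BetaPertH, NOT Clay.
-/

set_option autoImplicit false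

open scoped BigOperators Matrix Matrix.Norms.L2Operator Topology
open NormedSpace Finset Set Filter Metric Asymptotics

namespace Summit.QuantumFields.BalabanUV.T4Continuum.NE7MinimalActionDifferentiable

open Literature.MathematicalPhysics.QuantumFieldTheory.Balaban1983to89
open B7Prop1Explicit B7Prop2Explicit MatrixLog
open T4AveragingDeficitWall (IsUnitaryCfg SmallField fineAction vary)
open T4AveragingDeficitWallBoundary (IsPeriodicCfg)
open AveragingDeficitTorusChart (TDir chart chartDir chart_zero chart_smul redN isPeriodicCfg_chart isUnitaryCfg_chart)
open AveragingDeficitChartCalculus (relLog contDiffAt_fineAction_chart)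
open AveragingDeficitTwoLevelPrep (skewSub skewPR skewPF skewPF_of_mem)
open AveragingDeficitMultiLevelPrep (tower levelQ cavgIter)
open AveragingDeficitMultiLevelBridge (cavgIter_eq_avgIter)
open MinimalActionLevels (perWin levelAction stepWt stepWt_pos)
open MinimalActionSandwich (IsMinimiser admissible minAct)
open MinimalActionRate (sfClass)
open NE3EnergyShapes (IsUnitarySite IsPeriodicSite)
open NE7AdmissibleFibreLHC (period_succ_eq continuous_chart chart_id_eq_chart_skewP)
open NE7MinimalOrbitDatumContinuity (thresholds minAct_continuous)
open NE7MinimalOrbitUniqueGeneric (minimal_orbit_unique_generic)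
open NE7EtaMinimiserGaugeCovariance (levelAction_gaugeAct avgIter_gaugeAct_sfClass isUnitarySite_corner)
open NE7FibreStraightening (fibre_straightening)
open NE7MinimiserLipschitzPrep (isPeriodicSite_corner norm_vary_sub_le)
open NE7MinimiserLipschitzChart (minimiser_lipschitz_chart)
open BlockAverageCurrent (smallField_gaugeAct)
open B7BlockAvgLog (mlog_exp)

noncomputable section

variable {n : Type} [Fintype n] [DecidableEq n]

/-- The chart coordinate of the datum `chart_{V₀}(y)` is `y` itself (small `y`). [folklore] -/
theorem skewPR_relLog_chart_self {N : ℕ} [NeZero N] (V₀ : Site 4 → Fin 4 → (Matrix n n ℂ)ˣ) (y : ↥(skewSub 4 n N)) (hy : ‖y‖ < Real.log 2) :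
    skewPR N (relLog N V₀ (chart (ContinuousLinearMap.id ℝ (Matrix n n ℂ)) N V₀ (y : TDir 4 n N))) = y := by
  have hrel : relLog N V₀ (chart (ContinuousLinearMap.id ℝ (Matrix n n ℂ)) N V₀ (y : TDir 4 n N)) = (y : TDir 4 n N) := by
    funext r κ
    have hn : ‖(y : TDir 4 n N) r κ‖ < Real.log 2 :=
      lt_of_le_of_lt ((norm_le_pi_norm ((y : TDir 4 n N) r) κ).trans (norm_le_pi_norm (y : TDir 4 n N) r)) (by rwa [← Submodule.coe_norm] )
    simp only [relLog, chart, chartDir, Units.val_mul, val_expUnit, ContinuousLinearMap.id_apply, AveragingDeficitTorusChart.redN_boxVec, ← mul_assoc, Units.inv_mul, one_mul]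
    exact mlog_exp hn
  apply Subtype.ext
  rw [hrel]
  show skewPF N (y : TDir 4 n N) = (y : TDir 4 n N)
  exact skewPF_of_mem y.2

set_option maxHeartbeats 1600000 in
/-- **THE MINIMAL ACTION IS DIFFERENTIABLE IN THE DATUM AT A GENERIC SMALL DATUM.**  Over the small data, at every level `j+1` and every base datum `V₀` whose coarse stabiliser acts trivially
(every unitary `N`-periodic `s` with `s·V₀ = V₀` satisfies `s·D = D` for all `D`): there is a continuous linear `ℓ : skewSub N → ℝ` with
`HasFDerivAt (fun y => minAct 4 (sfClass 4 L N ε) L N (j+1) (chart_{V₀} y)) ℓ 0`. [folklore] -/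
theorem minAct_hasFDerivAt_generic [Nonempty n] {L : ℕ} [NeZero L] (hL : 2 ≤ L) :
    ∃ ε₀ : ℝ, 0 < ε₀ ∧ ∀ ε : ℝ, 0 < ε → ε ≤ ε₀ → ∀ (N : ℕ) [NeZero N], 1 ≤ N →
      ∃ δV : ℝ, 0 < δV ∧
        ∀ V₀ ∈ {V : Site 4 → Fin 4 → (Matrix n n ℂ)ˣ | IsUnitaryCfg V ∧ IsPeriodicCfg V (N : ℤ) ∧ SmallField V δV},
        (∀ s : Site 4 → (Matrix n n ℂ)ˣ, IsUnitarySite s → IsPeriodicSite s (N : ℤ) → gaugeAct s V₀ = V₀ → ∀ D : Site 4 → Fin 4 → (Matrix n n ℂ)ˣ, gaugeAct s D = D) →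
        ∀ j : ℕ, ∃ ℓ : ↥(skewSub 4 n N) →L[ℝ] ℝ,
          HasFDerivAt (fun y : ↥(skewSub 4 n N) => minAct 4 (sfClass 4 L N ε) L N (j + 1) (chart (ContinuousLinearMap.id ℝ (Matrix n n ℂ)) N V₀ (y : TDir 4 n N))) ℓ 0 := by
  have hL1 : 1 ≤ L := by omega
  obtain ⟨ε₁, hε₁, H⟩ := thresholds (n := n) hL
  obtain ⟨ε₂, hε₂, H2⟩ := minAct_continuous (n := n) hL
  obtain ⟨ε₃, hε₃, H3⟩ := minimal_orbit_unique_generic (n := n) hL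
  obtain ⟨ε₄, hε₄, H4⟩ := minimiser_lipschitz_chart (n := n) hL
  refine ⟨min ε₁ (min ε₂ (min ε₃ ε₄)), lt_min hε₁ (lt_min hε₂ (lt_min hε₃ hε₄)), fun ε hε hεle N _ hN => ?_⟩
  obtain ⟨-, -, hls, H1⟩ := H ε hε (hεle.trans (min_le_left _ _))
  obtain ⟨δ₁, hδ₁, hint₁⟩ := H1 N hN
  obtain ⟨δ₂, hδ₂, hcont⟩ := H2 ε hε (hεle.trans ((min_le_right _ _).trans (min_le_left _ _))) N hN
  obtain ⟨δ₃, hδ₃, huniq⟩ := H3 ε hε (hεle.trans ((min_le_right _ _).trans ((min_le_right _ _).trans (min_le_left _ _)))) N hN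
  obtain ⟨δ₄, hδ₄, hlip⟩ := H4 ε hε (hεle.trans ((min_le_right _ _).trans ((min_le_right _ _).trans (min_le_right _ _)))) N hN
  refine ⟨min δ₁ (min δ₂ (min δ₃ δ₄)), lt_min hδ₁ (lt_min hδ₂ (lt_min hδ₃ hδ₄)), fun V₀ hV₀ hgen j => ?_⟩
  obtain ⟨hV₀u, hV₀P, hV₀δ⟩ := hV₀
  have hV₀1 : V₀ ∈ {V : Site 4 → Fin 4 → (Matrix n n ℂ)ˣ | IsUnitaryCfg V ∧ IsPeriodicCfg V (N : ℤ) ∧ SmallField V δ₁} :=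
    ⟨hV₀u, hV₀P, MinimalActionRate.SmallField.mono hV₀δ (min_le_left _ _)⟩
  have hV₀2 : V₀ ∈ {V : Site 4 → Fin 4 → (Matrix n n ℂ)ˣ | IsUnitaryCfg V ∧ IsPeriodicCfg V (N : ℤ) ∧ SmallField V δ₂} :=
    ⟨hV₀u, hV₀P, MinimalActionRate.SmallField.mono hV₀δ ((min_le_right _ _).trans (min_le_left _ _))⟩
  have hV₀3 : V₀ ∈ {V : Site 4 → Fin 4 → (Matrix n n ℂ)ˣ | IsUnitaryCfg V ∧ IsPeriodicCfg V (N : ℤ) ∧ SmallField V δ₃} :=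
    ⟨hV₀u, hV₀P, MinimalActionRate.SmallField.mono hV₀δ ((min_le_right _ _).trans ((min_le_right _ _).trans (min_le_left _ _)))⟩
  have hV₀4 : V₀ ∈ {V : Site 4 → Fin 4 → (Matrix n n ℂ)ˣ | IsUnitaryCfg V ∧ IsPeriodicCfg V (N : ℤ) ∧ SmallField V δ₄} :=
    ⟨hV₀u, hV₀P, MinimalActionRate.SmallField.mono hV₀δ ((min_le_right _ _).trans ((min_le_right _ _).trans (min_le_right _ _)))⟩
  -- the Lipschitz-chart minimiser `U♯` over `V₀` and its interiority (via the orbit of an interior minimiser)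
  obtain ⟨Us, hUs, C, hC, hlipev⟩ := hlip V₀ hV₀4 j
  obtain ⟨U₀, hU₀, a, ha0, haε, hU₀a⟩ := hint₁ V₀ hV₀1 (j + 1)
  obtain ⟨Ur, -, horbit⟩ := huniq V₀ hV₀3 (j + 1)
  obtain ⟨u₁, hu₁, -, hg₁⟩ := horbit U₀ hU₀
  obtain ⟨u₂, hu₂, -, hg₂⟩ := horbit Us hUs
  have hUsa : SmallField Us a := by
    have h1 : SmallField Ur a := by rw [← hg₁]; exact smallField_gaugeAct hu₁ hU₀a
    have h2 : gaugeAct (fun z => (u₂ z)⁻¹) Ur = Us := by rw [← hg₂, AveragingDeficitKDatum.gaugeAct_inv_gaugeAct]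
    rw [← h2]; exact smallField_gaugeAct (fun z => (unitaryUnits _).inv_mem (hu₂ z)) h1
  set M : ℕ := L * tower L N j with hMdef
  have hper : N * L ^ (j + 1) = M := by rw [hMdef]; exact period_succ_eq L N j
  haveI : NeZero M := ⟨by rw [← hper]; exact Nat.mul_ne_zero (NeZero.ne N) (pow_ne_zero _ (by omega))⟩
  have hUsavg : cavgIter L (j + 1) Us = V₀ := by rw [cavgIter_eq_avgIter]; exact hUs.mem.2
  set w : ℝ := ((stepWt 4 L)⁻¹) ^ (j + 1) with hw
  have hw0 : 0 < w := pow_pos (inv_pos.mpr (stepWt_pos (d := 4) L hL1)) _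
  have hlev : ∀ Z : Site 4 → Fin 4 → (Matrix n n ℂ)ˣ, levelAction 4 L N (j + 1) Z = w * fineAction Z (perWin 4 (N * L ^ (j + 1))) := fun Z => by rw [hw]; rfl
  -- the straightening and the straightened action `f`
  obtain ⟨θ, Kθ, ρ₀, hKθ, hρ₀, hθ0, hθc, -, hθid, hθfib⟩ := fibre_straightening (d := 4) (n := n) hL1 hε.le (hls j) hUs.mem haε hUsa
  set ch : ↥(skewSub 4 n M) → (Site 4 → Fin 4 → (Matrix n n ℂ)ˣ) := fun Φ => chart (ContinuousLinearMap.id ℝ (Matrix n n ℂ)) M Us (Φ : TDir 4 n M) with hch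
  set f : ↥(skewSub 4 n N) × ↥(skewSub 4 n M) → ℝ := fun p => fineAction (ch (θ p)) (perWin 4 (N * L ^ (j + 1))) with hfdef
  have hfc : ContDiffAt ℝ 2 f 0 := by
    have hA : ContDiffAt ℝ 2 (fun Φ : ↥(skewSub 4 n M) => fineAction (ch Φ) (perWin 4 (N * L ^ (j + 1)))) (θ 0) := by
      rw [hθ0]
      exact (contDiffAt_fineAction_chart (m := 2) (ContinuousLinearMap.id ℝ (Matrix n n ℂ)) M Us (perWin 4 (N * L ^ (j + 1))) _).comp (0 : ↥(skewSub 4 n M))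
        (skewSub 4 n M).subtypeL.contDiff.contDiffAt
    exact hA.comp 0 hθc
  have hfd : HasFDerivAt f (fderiv ℝ f 0) 0 := (hfc.differentiableAt (by norm_num)).hasFDerivAt
  set Df := fderiv ℝ f 0 with hDf
  refine ⟨w • Df.comp (ContinuousLinearMap.inl ℝ ↥(skewSub 4 n N) ↥(skewSub 4 n M)), ?_⟩
  have hf0 : f 0 = fineAction Us (perWin 4 (N * L ^ (j + 1))) := by simp only [hfdef, hθ0, hch, Submodule.coe_zero, chart_zero]
  -- the data `D_y = chart_{V₀} y`: unitary, periodic, near `V₀`, coordinate `y`, tending to `V₀`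
  set Dy : ↥(skewSub 4 n N) → (Site 4 → Fin 4 → (Matrix n n ℂ)ˣ) := fun y => chart (ContinuousLinearMap.id ℝ (Matrix n n ℂ)) N V₀ (y : TDir 4 n N) with hDy
  have hDyu : ∀ y, IsUnitaryCfg (Dy y) := fun y => by
    show IsUnitaryCfg (chart (ContinuousLinearMap.id ℝ (Matrix n n ℂ)) N V₀ (y : TDir 4 n N))
    rw [chart_id_eq_chart_skewP V₀ y.2]; exact isUnitaryCfg_chart N hV₀u _
  have hDyP : ∀ y, IsPeriodicCfg (Dy y) (N : ℤ) := fun y => isPeriodicCfg_chart _ N hV₀P _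
  have hDy0 : Dy 0 = V₀ := by simp [hDy]
  have hDyt : Tendsto Dy (𝓝 0) (𝓝 V₀) := by
    have h := ((continuous_chart (ContinuousLinearMap.id ℝ (Matrix n n ℂ)) N V₀).comp continuous_subtype_val).tendsto (0 : ↥(skewSub 4 n N))
    rwa [Function.comp_apply, Submodule.coe_zero, chart_zero] at h
  have hDynear : ∀ y : ↥(skewSub 4 n N), ‖y‖ ≤ 1 / 8 → ∀ (r : Fin 4 → Fin N) (κ' : Fin 4),
      ‖(((V₀ (boxVec N r) κ')⁻¹ : (Matrix n n ℂ)ˣ) : Matrix n n ℂ) * ((Dy y (boxVec N r) κ' : (Matrix n n ℂ)ˣ) : Matrix n n ℂ) - 1‖ ≤ 1 / 4 := by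
    intro y hy r κ'
    have hcv : Dy y = vary V₀ (chartDir (ContinuousLinearMap.id ℝ (Matrix n n ℂ)) N (y : TDir 4 n N)) 1 := by
      show chart _ N V₀ _ = _; rw [← chart_smul, one_smul]
    have hcomp : ‖chartDir (ContinuousLinearMap.id ℝ (Matrix n n ℂ)) N (y : TDir 4 n N) (boxVec N r) κ'‖ ≤ ‖y‖ := by
      simp only [chartDir, ContinuousLinearMap.id_apply]
      rw [Submodule.coe_norm]
      exact (norm_le_pi_norm ((y : TDir 4 n N) (redN N (boxVec N r))) κ').trans (norm_le_pi_norm _ _)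
    rw [hcv]
    exact (norm_vary_sub_le (W := V₀) (boxVec N r) κ' (hcomp.trans (by linarith))).trans (by linarith)
  have hDycoord : ∀ y : ↥(skewSub 4 n N), ‖y‖ ≤ 1 / 8 → skewPR N (relLog N V₀ (Dy y)) = y := fun y hy =>
    skewPR_relLog_chart_self V₀ y (lt_of_le_of_lt hy (by have := Real.log_two_gt_d9; linarith))
  -- existence of minimisers near `V₀`
  obtain ⟨Us2, hUs2, hexist⟩ := hcont V₀ hV₀2 (j + 1)
  have hexev : ∀ᶠ V in 𝓝 V₀, IsUnitaryCfg V → IsPeriodicCfg V (N : ℤ) → ∃ U, IsMinimiser 4 (sfClass 4 L N ε) L N (j + 1) V U :=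
    (hexist 1 one_pos).mono fun V hV hVu hVP => (hV hVu hVP).1
  -- THE LITTLE-o ESTIMATE
  rw [hasFDerivAt_iff_isLittleO_nhds_zero]
  refine Asymptotics.isLittleO_iff.mpr fun c hc => ?_
  -- `f`'s little-o at `0`, with constant `c′`
  set c' : ℝ := c / (w * (2 + 2 * C)) with hc'
  have hc'0 : 0 < c' := by positivity
  have hfo := (hasFDerivAt_iff_isLittleO_nhds_zero.mp hfd).def hc'0
  obtain ⟨rf, hrf, hballf⟩ := Metric.mem_nhds_iff.mp hfo
  -- pull the eventual conditions in `V` back to `y → 0`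
  have hy8 : ∀ᶠ y : ↥(skewSub 4 n N) in 𝓝 0, ‖y‖ < min (1 / 8) (min (ρ₀ / (2 + 2 * C)) (rf / (2 + 2 * C))) := by
    have h := eventually_norm_sub_lt (0 : ↥(skewSub 4 n N)) (lt_min (by norm_num : (0:ℝ) < 1 / 8) (lt_min (by positivity : (0:ℝ) < ρ₀ / (2 + 2 * C)) (by positivity : (0:ℝ) < rf / (2 + 2 * C))))
    exact h.mono fun y hy => by simpa using hy
  filter_upwards [hy8, hDyt.eventually hexev, hDyt.eventually hlipev] with y hy hyex hylip
  have hy1 : ‖y‖ < 1 / 8 := hy.trans_le (min_le_left _ _)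
  have hyρ' : ‖y‖ < ρ₀ / (2 + 2 * C) := hy.trans_le ((min_le_right _ _).trans (min_le_left _ _))
  have hyr' : ‖y‖ < rf / (2 + 2 * C) := hy.trans_le ((min_le_right _ _).trans (min_le_right _ _))
  have hyρ : (1 + C) * ‖y‖ < ρ₀ / 2 := by
    have h := (lt_div_iff₀ (by positivity : (0:ℝ) < 2 + 2 * C)).mp hyρ'; nlinarith
  have hyr : (1 + C) * ‖y‖ < rf / 2 := by
    have h := (lt_div_iff₀ (by positivity : (0:ℝ) < 2 + 2 * C)).mp hyr'; nlinarith
  have hy0 : 0 ≤ ‖y‖ := norm_nonneg _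
  have hCy : 0 ≤ C * ‖y‖ := mul_nonneg hC hy0
  have hyn := hDynear y hy1.le
  have hyco := hDycoord y hy1.le
  obtain ⟨Uy, hUy⟩ := hyex (hDyu y) (hDyP y)
  simp only [zero_add]
  -- UPPER BOUND via the straightened competitor `θ(y, 0)` over `D_y`
  have hnu : ‖((y, (0 : ↥(skewSub 4 n M))) : ↥(skewSub 4 n N) × ↥(skewSub 4 n M))‖ = ‖y‖ := by
    rw [Prod.norm_mk, norm_zero, max_eq_left (norm_nonneg _)]
  obtain ⟨-, -, hadm_up⟩ := hθfib (y, 0) (by rw [hnu]; nlinarith)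
  have hadm_u := hadm_up (Dy y) (hDyu y) (hDyP y) hyn (by rw [hyco])
  have hup : minAct 4 (sfClass 4 L N ε) L N (j + 1) (Dy y) ≤ w * f (y, 0) := by
    have h := hUy.minAct_le hadm_u; rwa [hlev] at h
  -- the value at `0`
  have hA0 : minAct 4 (sfClass 4 L N ε) L N (j + 1) (Dy 0) = w * f 0 := by
    rw [hDy0, hUs.minAct_eq, hlev, hf0]
  -- LOWER BOUND via the Lipschitz-close stabiliser copy over `D_y` itself (genericity)
  obtain ⟨u, Φ, hu, huP, hufix, hcopy, hΦn⟩ := hylip (hDyu y) (hDyP y) Uy hUy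
  rw [hyco] at hΦn
  set ub : Site 4 → (Matrix n n ℂ)ˣ := fun z : Site 4 => u (((L : ℤ) ^ (j + 1)) • z) with hub
  have hubu : IsUnitarySite ub := fun z => isUnitarySite_corner hu _ z
  have hubP : IsPeriodicSite ub (N : ℤ) := by
    have h : IsPeriodicSite (fun z : Site 4 => u (((L ^ (j + 1) : ℕ) : ℤ) • z)) (N : ℤ) := isPeriodicSite_corner huP
    simpa only [Nat.cast_pow] using h
  have hubfix : gaugeAct ub V₀ = V₀ := by
    funext z κ; exact Units.ext (by have h := hufix z κ; simpa only [hub, gaugeAct, Units.val_mul] using h)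
  have hXavg : avgIter L (gaugeAct u Uy) (j + 1) = Dy y := by
    rw [avgIter_gaugeAct_sfClass hL1 hε.le j (hls j) hUy.mem.1 hu, hUy.mem.2]
    exact hgen ub hubu hubP hubfix (Dy y)
  have hchΦ : ch Φ = gaugeAct u Uy := hcopy.symm
  have hQΦ : levelQ L N j Us (ch Φ) = y := by
    show skewPR N (relLog N (cavgIter L (j + 1) Us) (cavgIter L (j + 1) (ch Φ))) = y
    rw [hUsavg, cavgIter_eq_avgIter, hchΦ, hXavg, hyco]
  have hΦρ : ‖Φ‖ < ρ₀ := by nlinarith [hΦn]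
  have hθΦ : θ (y, Φ) = Φ := by rw [← hQΦ]; exact hθid Φ hΦρ
  have hAy : minAct 4 (sfClass 4 L N ε) L N (j + 1) (Dy y) = w * f (y, Φ) := by
    have h1 : f (y, Φ) = fineAction (ch Φ) (perWin 4 (N * L ^ (j + 1))) := by simp only [hfdef, hθΦ]
    rw [h1, hUy.minAct_eq, ← levelAction_gaugeAct L N (j + 1) u Uy, hlev, hchΦ]
  have hnv : ‖(((0 : ↥(skewSub 4 n N)), Φ) : ↥(skewSub 4 n N) × ↥(skewSub 4 n M))‖ = ‖Φ‖ := by rw [Prod.norm_mk, norm_zero, max_eq_right (norm_nonneg _)]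
  have hnyΦ : ‖((y, Φ) : ↥(skewSub 4 n N) × ↥(skewSub 4 n M))‖ ≤ (1 + C) * ‖y‖ := by
    rw [Prod.norm_mk]; exact max_le (by nlinarith) (by nlinarith)
  -- admissibility of `θ(0, Φ)` over `V₀` ⇒ `A(0) ≤ w f(0, Φ)`
  obtain ⟨-, -, hadm_lo⟩ := hθfib (0, Φ) (by rw [hnv]; exact hΦρ)
  have hV₀near : ∀ (r : Fin 4 → Fin N) (κ' : Fin 4),
      ‖(((V₀ (boxVec N r) κ')⁻¹ : (Matrix n n ℂ)ˣ) : Matrix n n ℂ) * (V₀ (boxVec N r) κ' : Matrix n n ℂ) - 1‖ ≤ 1 / 4 := fun r κ' => by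
    rw [Units.inv_mul, sub_self, norm_zero]; norm_num
  have hadm_l := hadm_lo V₀ hV₀u hV₀P hV₀near (by rw [AveragingDeficitChartCalculus.relLog_self, map_zero])
  have hlo : w * f 0 ≤ w * f (0, Φ) := by
    have h := hUs.minAct_le hadm_l; rwa [hUs.minAct_eq, hlev, hlev, ← hf0] at h
  -- the three little-o instances
  have hmemf : ∀ p : ↥(skewSub 4 n N) × ↥(skewSub 4 n M), ‖p‖ < rf → ‖f p - f 0 - Df p‖ ≤ c' * ‖p‖ := by
    intro p hp
    have h := hballf (mem_ball_zero_iff.mpr hp)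
    simpa only [mem_setOf_eq, zero_add, sub_zero] using h
  have ho1 := hmemf (y, 0) (by rw [hnu]; nlinarith)
  have ho2 := hmemf (y, Φ) (lt_of_le_of_lt hnyΦ (by linarith))
  have ho3 := hmemf (0, Φ) (by rw [hnv]; nlinarith)
  rw [hnu] at ho1
  rw [hnv] at ho3
  have ho2' : ‖f (y, Φ) - f 0 - Df (y, Φ)‖ ≤ c' * ((1 + C) * ‖y‖) := ho2.trans (mul_le_mul_of_nonneg_left hnyΦ hc'0.le)
  have ho3' : ‖f (0, Φ) - f 0 - Df (0, Φ)‖ ≤ c' * (C * ‖y‖) := ho3.trans (mul_le_mul_of_nonneg_left hΦn hc'0.le)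
  -- linear algebra of `Df`
  have hDfsplit : Df (y, Φ) - Df (0, Φ) = Df (y, 0) := by
    rw [← map_sub]; congr 1; ext <;> simp
  have hlin : (w • Df.comp (ContinuousLinearMap.inl ℝ ↥(skewSub 4 n N) ↥(skewSub 4 n M))) y = w * Df (y, 0) := by
    simp [ContinuousLinearMap.comp_apply, ContinuousLinearMap.inl_apply, smul_eq_mul]
  rw [hlin, hA0, Real.norm_eq_abs]
  -- the constant bookkeeping: `w c′ (1 + 2C) ≤ c`
  have hwc : w * c' * (2 + 2 * C) = c := by
    rw [hc']; field_simp
  rw [Real.norm_eq_abs] at ho1 ho2' ho3'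
  have hb1 := abs_le.mp ho1
  have hb2 := abs_le.mp ho2'
  have hb3 := abs_le.mp ho3'
  rw [abs_le]
  constructor
  · -- lower bound
    have h1 : w * f (y, Φ) - w * f (0, Φ) ≤ minAct 4 (sfClass 4 L N ε) L N (j + 1) (Dy y) - w * f 0 := by rw [hAy]; linarith
    have h2 : f (y, Φ) - f (0, Φ) - Df (y, 0) = (f (y, Φ) - f 0 - Df (y, Φ)) - (f (0, Φ) - f 0 - Df (0, Φ)) := by rw [← hDfsplit]; ring
    nlinarith [hb2.1, hb3.2, hw0, h1, h2, hc'0]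
  · -- upper bound
    nlinarith [hb1.2, hw0, hup, hc'0]

end

end Summit.QuantumFields.BalabanUV.T4Continuum.NE7MinimalActionDifferentiable
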